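import Summits.QuantumFields.YangMills.Theorems.LuscherReductionTwistedTraceScalingWindowTube
import Summits.QuantumFields.YangMills.Theorems.LuscherReductionTwistedTraceScalingWindowDefs
import Summits.QuantumFields.YangMills.Theorems.LuscherReductionTwistedTraceScalingC4CoreRecord
import HarnessLib

/-!
# ★★★ THE `k`-UNIFORM INNER WINDOW AT ONE ORBIT, UNCONDITIONAL at the record radius `β^{−s}`, `1/6 < s < 1/5`, `L ≥ 2` (brick W4 of the lattice window floor W(L);
# lane A of S-BASE, crux `TwistedTraceScaling` stmt-QuantumFields-20203, line «twolattice», stub `stub_fixedLatticeTraceLaw`; card `pub/ym-fleet/ym-luscher-20007-p1/Lines-window-floor.md`; lead g24)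

The `k`-uniform twins of ✓`innerNoIntruderOneOrbitAt_of_softTubeOn` (exact gauge slice `f = Gχ/N`, ✓`sliceFn`), ✓`innerNoIntruderOneOrbitAt_of_recordInput` (the record weight `recordChi L s K M`,
✓`boBricks_record`, (P) ✓`fpWeight_core_constant`), ✓`innerNoIntruderOneOrbitAt_of_analyticInput` and ✓`innerNoIntruderOneOrbitAt_record` ((B-ST) pen ✓`recordAnalyticInput`), fed with the `k`-uniform
tube window ✓`softTubeWindow_of_bricks` (W3) instead of the per-level package:
* ★★★ `innerWindowOneOrbitAt_of_bricks : SoftTubeAdmissible L δ χ → BOBricks L χ δ → InnerWindowOneOrbitAt L δ` (`θ = 1 − θ₀/2`);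
* `innerWindowOneOrbitAt_of_recordInput`, `innerWindowOneOrbitAt_of_analyticInput`;
* ★★★ `innerWindowOneOrbitAt_record (hL : 2 ≤ L) (hs6 : 1/6 < s) (hs5 : s < 1/5) : InnerWindowOneOrbitAt L (powScale s)` — UNCONDITIONAL.
HONEST FRAMING: compositions at FIXED lattice size `L ≥ 2`, eventually in `β`; W(L), S-BASE, `stub_cmpTwoLoop`, `stub_labelTracking` and the crux `TwistedTraceScaling` stay OPEN; CONDITIONAL route R2b1
(Lüscher two-lattice reduction); not infinite volume, not a mass gap, not Clay.  No definitions, no `sorry`.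
-/

set_option autoImplicit false

noncomputable section

open MeasureTheory Filter Topology Real
open scoped BigOperators
open Literature.MathematicalPhysics.QuantumFieldTheory
open Literature.MathematicalPhysics.QuantumLattice

namespace Summit.QuantumFields.YangMills.Theorems.FemtoTransferGap.TwoLattice.ConstTube

open Summit.QuantumFields.YangMills.Theorems.FemtoTransferGap
open Summit.QuantumFields.YangMills.Theorems.FemtoTransferGap.TwoLattice.Avg

variable {L : ℕ} [NeZero L]

/-! ## §1 ★★★ One orbit from the bricks (exact gauge slice) -/

set_option maxHeartbeats 400000 in
/-- ★★★ **THE `k`-UNIFORM INNER WINDOW AT ONE ORBIT FROM THE BRICKS**: for a weight admissible at radius `δ` and a brick list `K : BOBricks L χ δ`, `InnerWindowOneOrbitAt L δ` holds with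
`θ = 1 − θ₀/2` (`θ₀ = K.θ₀`).  The slice function `f = Gχ/N` of a gauge-invariant `G` supported in `{orbitDist < δ}` is an admissible tube function with `‖G‖² = ‖f‖²_w` and
`⟨G, K_β G⟩ = T(f)` (✓`qform_eq_integral_avgKernel`, ✓`l2_eq_sliceFn_left`); apply ✓`softTubeWindow_of_bricks`. [cite: Luscher1983, §3] [cite: SeilerLNP1982, §3] -/
theorem innerWindowOneOrbitAt_of_bricks {δ : ℝ → ℝ} {χ : ℝ → GaugeConfig 3 L SU2 → ℝ} (hT : SoftTubeAdmissible L δ χ) (K : BOBricks L χ δ) :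
    InnerWindowOneOrbitAt L δ := by
  obtain ⟨hχm, hχb, β1, hβ1⟩ := hT
  obtain ⟨hθ0, hθ1⟩ := K.hθ₀
  refine ⟨1 - K.θ₀ / 2, by linarith, fun ε hε => ?_⟩
  obtain ⟨β0, hβ0⟩ := softTubeWindow_of_bricks K ε hε
  refine ⟨max β0 β1, fun β hβ k G hGm hGb hGinv hGsupp hGind => ?_⟩
  have hβ0' : β0 ≤ β := (le_max_left _ _).trans hβ
  obtain ⟨hcov, n₀, hn₀, hNlow⟩ := hβ1 β ((le_max_right _ _).trans hβ)
  obtain ⟨Cχ, hCχ⟩ := hχb β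
  set f : Fin (k + 1) → GaugeConfig 3 L SU2 → ℝ := fun i => Avg.sliceFn (χ β) (G i) with hf_def
  have hψ : ∀ a : Fin (k + 1) → ℝ,
      Measurable (fun U => ∑ i, a i * G i U) ∧ (∃ C : ℝ, ∀ U, |∑ i, a i * G i U| ≤ C) ∧
        (∀ (g : Site 3 L → SU2) (U : GaugeConfig 3 L SU2), (∑ i, a i * G i (gaugeTransform g U)) = ∑ i, a i * G i U) ∧
        (∀ U, (∑ i, a i * G i U) ≠ 0 → gaugeAvg (χ β) U ≠ 0) := fun a =>
    ⟨measurable_combination hGm a, bounded_combination hGb a, invariant_combination hGinv a, fun U hU => by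
      obtain ⟨i, hi⟩ := exists_ne_zero_of_combination_ne_zero hU
      exact (hcov U (hGsupp i U hi)).ne'⟩
  have hslice : ∀ a : Fin (k + 1) → ℝ, Avg.sliceFn (χ β) (fun U => ∑ i, a i * G i U) = fun U => ∑ i, a i * f i U := fun a => Avg.sliceFn_sum (χ β) a G
  have hpack : ∀ a : Fin (k + 1) → ℝ,
      l2 (fun U => ∑ i, a i * G i U) (fun U => ∑ i, a i * G i U) = tubeNormSq (softWeight (χ β)) (fun U => ∑ i, a i * f i U) ∧
      qform su2Rep β (fun U => ∑ i, a i * G i U) (fun U => ∑ i, a i * G i U) = tubeForm β (fun U => ∑ i, a i * f i U) := fun a => by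
    obtain ⟨hm, ⟨C, hC⟩, hinv, hcv⟩ := hψ a
    have h1 := qform_eq_integral_avgKernel β (hχm β) hCχ hn₀ hNlow hm hC hinv hcv hm hC hinv hcv
    have h2 := l2_eq_sliceFn_left (hχm β) hCχ hn₀ hNlow hm hC hinv hcv hm hC hinv
    rw [hslice a] at h1 h2
    refine ⟨?_, h1⟩
    rw [h2]
    unfold l2 tubeNormSq
    refine integral_congr_ae (ae_of_all _ fun U => ?_)
    have h3 := sliceFn_mul_self_eq (ψ := fun U => ∑ i, a i * G i U) hn₀ hNlow U
    rw [hslice a] at h3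
    exact h3
  have hfm : ∀ i, Measurable (f i) := fun i => Avg.measurable_sliceFn (hχm β) (hGm i)
  have hfb : ∀ i, ∃ C : ℝ, ∀ U, |f i U| ≤ C := fun i => by
    obtain ⟨C, hC⟩ := hGb i
    exact ⟨C * Cχ / n₀, Avg.abs_sliceFn_le hCχ hC hn₀ hNlow⟩
  have hfsupp : ∀ i U, f i U ≠ 0 → χ β U ≠ 0 := fun i U hU => (Avg.sliceFn_ne_zero hU).1
  have hfS : ∀ i U, f i U ≠ 0 → orbitDist U < δ β := fun i U hU => hGsupp i U (Avg.sliceFn_ne_zero hU).2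
  have hfind : ∀ a : Fin (k + 1) → ℝ, a ≠ 0 → 0 < tubeNormSq (softWeight (χ β)) (fun U => ∑ i, a i * f i U) := fun a ha => by
    rw [← (hpack a).1]; exact hGind a ha
  obtain ⟨a, ha, hle⟩ := hβ0 β hβ0' k f hfm hfb hfsupp hfS hfind
  refine ⟨a, ha, ?_⟩
  rw [(hpack a).2, (hpack a).1]
  exact hle

/-! ## §2 The record weight -/

/-- ★★★ **The window from the record input** (`L` with a nonzero site, `0 < s ≤ 1/3`, `K ≥ 1`): there is `M₀ ≥ 2` such that for every `M ≥ M₀`, a `RecordBOInput L s K M` yields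
`InnerWindowOneOrbitAt L β^{−s}` ((P) ✓`fpWeight_core_constant` supplies (B-N), ✓`boBricks_record` the brick list, §1 the window; admissibility ✓`softTubeAdmissible_recordWeightRho`).
[cite: Luscher1983, §3] -/
theorem innerWindowOneOrbitAt_of_recordInput (hL : Nonempty (NzSite L)) {s : ℝ} (hs : 0 < s) (hs3 : s ≤ 1 / 3) {K : ℝ} (hK : 1 ≤ K) :
    ∃ M₀ : ℝ, 2 ≤ M₀ ∧ ∀ M : ℝ, M₀ ≤ M → RecordBOInput L s K M → InnerWindowOneOrbitAt L (powScale s) := by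
  have hδ0 : ∀ β, 0 < K * powScale s β := fun β => mul_pos (by linarith) (powScale_pos s β)
  have hδt : Tendsto (fun β => K * powScale s β) atTop (𝓝 0) := by
    have := (tendsto_powScale hs).const_mul K; simpa using this
  have hsd : ∀ᶠ β in atTop, 0 < powScale 1 β ∧ powScale 1 β ≤ (K * powScale s β) ^ 3 := by
    filter_upwards [Filter.eventually_ge_atTop (1 : ℝ)] with β hβ
    refine ⟨powScale_pos 1 β, (powScale_one_le_cube hs3 hβ).trans ?_⟩
    have hp := powScale_pos s β
    have h1 : powScale s β ≤ K * powScale s β := by nlinarith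
    exact pow_le_pow_left₀ hp.le h1 3
  obtain ⟨M₀, hM₀, hPM⟩ := fpWeight_core_constant L hL hδ0 hδt hsd
  refine ⟨M₀, hM₀, fun M hM I => ?_⟩
  obtain ⟨C, β₀, -, hP⟩ := hPM M hM
  have hM1 : 1 ≤ M := by linarith
  have hM2 : 2 ≤ M := hM₀.trans hM
  have B : BOBricks L (recordChi L s K M) (powScale s) := boBricks_record hs hM1 I (C := C) (β₀ := β₀) fun β hβ U hU => hP β hβ U hU
  have hadm : SoftTubeAdmissible L (powScale s) (recordChi L s K M) :=
    softTubeAdmissible_mono (fun β => by have := powScale_pos s β; show powScale s β ≤ K * powScale s β; nlinarith)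
      (softTubeAdmissible_recordWeightRho L hδ0 (fun β => by
        have : 0 ≤ K * powScale s β := (hδ0 β).le
        show 2 * (K * powScale s β) ≤ M * (K * powScale s β); nlinarith))
  exact innerWindowOneOrbitAt_of_bricks hadm B

/-- ★★★ **The window from the ANALYTIC input alone** (`0 < s < 1/5`; the structural fields from the tree, ✓`RecordAnalyticInput.toRecordBOInput`). [cite: Luscher1983, §3] -/
theorem innerWindowOneOrbitAt_of_analyticInput (hL : Nonempty (NzSite L)) {s : ℝ} (hs : 0 < s) (hs5 : s < 1 / 5) :
    ∃ M₀ : ℝ, 2 ≤ M₀ ∧ ∀ M : ℝ, M₀ ≤ M → RecordAnalyticInput L s M → InnerWindowOneOrbitAt L (powScale s) := by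
  obtain ⟨M₀, hM₀, h⟩ := innerWindowOneOrbitAt_of_recordInput (L := L) hL hs (by linarith) (K := 43) (by norm_num)
  exact ⟨M₀, hM₀, fun M hM A => h M hM (A.toRecordBOInput hs hs5 (by linarith))⟩

/-- ★★★ **THE `k`-UNIFORM INNER WINDOW AT ONE ORBIT AT THE RECORD RADIUS, UNCONDITIONAL** (`L ≥ 2`, `1/6 < s < 1/5`): the (B-ST) pen ✓`recordAnalyticInput` inhabits the analytic input
at every large fat factor; compose with `innerWindowOneOrbitAt_of_analyticInput` at a common `M`. [cite: Luscher1983, §3] [cite: SjostrandZworski2007, §2] -/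
theorem innerWindowOneOrbitAt_record (hL : 2 ≤ L) {s : ℝ} (hs6 : 1 / 6 < s) (hs5 : s < 1 / 5) : InnerWindowOneOrbitAt L (powScale s) := by
  have hLz : Nonempty (NzSite L) := nonempty_nzSite_of_two_le hL
  obtain ⟨M₀, -, hrec⟩ := recordAnalyticInput (L := L) hLz hL hs6 (by linarith)
  obtain ⟨M₁, -, hwin⟩ := innerWindowOneOrbitAt_of_analyticInput (L := L) hLz (by linarith) hs5
  obtain ⟨A⟩ := hrec (max M₀ M₁) (le_max_left _ _)
  exact hwin (max M₀ M₁) (le_max_right _ _) A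

end Summit.QuantumFields.YangMills.Theorems.FemtoTransferGap.TwoLattice.ConstTube

end
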